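import Literature.MathematicalPhysics.QuantumFieldTheory.King1986.CovarianceSplittingUnits
import Literature.MathematicalPhysics.QuantumFieldTheory.Balaban1983to89.B1RG242
import HarnessLib

/-!
# King 1986 (2.17) IS Bałaban 1982 (2.42)–(2.43): King's two-level block data on the nested torus AS A `B1RG242.StepData`,
# the dictionary `G_k ∕ Δ^{(k)} ∕ C^{(k)} ∕ a_{k+1}L⁻² ∕ G_{k+1}` ↔ `Gk ∕ Δk ∕ Ck ∕ γ ∕ Gk1`, and B1's kernel-proved step identities
# (2.42), (2.41), (2.18)∕(2.21) read on King's operators BY NAME — in particular the operator-level composition law of the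
# effective Laplacian (2.14)

**Citation header (third file of the `CovarianceSplitting` group; seat `pub-ymgap-dag-n15-e` (generation 5) of the cell
`pub-ymgap`, Track-A node N15 = NE2, King-model rung).**  C. King, *The U(1) Higgs model. I. The continuum limit*, Commun.
Math. Phys. **102** (1986) 649–677 [King1986], §2.2 p. 653 (2.13)–(2.17); T. Bałaban, *(Higgs)₂,₃ quantum fields in a
finite volume. I. A lower bound*, Commun. Math. Phys. **85** (1982) 603–636 [Balaban1982Higgs1], §2 pp. 608–612 (2.7),
(2.11)–(2.14), (2.17)–(2.21), (2.30), (2.41)–(2.43).  King's (2.13)–(2.17) ARE Bałaban's (2.20), (2.21), (2.30), (2.43) at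
`N = 1`, `A = 0` (King p. 652: «We present below a collection of relevant notation and formulae connected with the
method» of [Ba 1–4]); the tree kernel-proves (2.41)∕(2.42)∕(2.43) for ABSTRACT step data on any finite carrier in
`Balaban1983to89/B1RG242` (`StepData.display242`, `display241`, `display221_succ`, `Tower.display243`) and instantiates
them for Bałaban's concrete scalar tower on the tori `Site P j` in `B1RG242Torus`.  `King1986/CovarianceSplitting` proved
the one-step identity INDEPENDENTLY for the `King1986.Torus` operators (`fineOp`, `effLaplacian`, `minimiser`, `Qmat`,
`blockProj`) on the general nested torus `Tor (fine N (fine L M))`; THIS FILE is the knit: it packages those operators as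
a `B1RG242.StepData` and re-derives the splitting — and B1's two other step identities — from B1's theorems by name.

**The dictionary (`kingStep N L M a₁ a c m²`, level-`k` units, `η = N⁻¹`).**  `H := N^{−d}·(c(−Δ) + m²)` (the `η^d`-weighted
fine action, B1 (2.17) at `A = 0`), `Qk := Qmat N (fine L M)`, `Qks := Qkᵀ` (so `Pk = QkᵀQk = N^{−d}·blockProj` and
`H + α·Pk = N^{−d}·A₀`, `Gk = N^d·A₀⁻¹ = constrainedProp` — `kingStep_Gk`), `Q := Qmat L M`, `Qs := L^d·Qᵀ` (the unit-lattice
adjoint: `QQs = 1` — `kingStep_QQs`; `P = QsQ = blockProj L M` — `kingStep_P`), `α := a₁`, `β := aL⁻²`; then `Δk = effLaplacian`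
(`kingStep_Δk`, King's (2.14) = B1 (2.21)), `Ck = oneStepCov` (`kingStep_Ck`, (2.16) = (2.30)), `γ = αβ∕(α+β) = nextLevelCoeff`
(`kingStep_γ`, (2.13)), `Qk1 = Qmat₂` (`kingStep_Qk1`), `Pk1 = N^{−d}·blockProj₂`, `Gk1 = constrainedProp₂` (`kingStep_Gk1`).

**What this file PROVES (kernel).**  The dictionary lemmas above, the four hypotheses of B1's step theorems for King's
data (`kingStep_QQs`, `kingStep_αβ_ne`, `kingStep_isUnit_G`, `kingStep_isUnit_C`), and BY NAME from `B1RG242.StepData`: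
* **`constrainedProp₂_eq_of_display242`** — B1 (2.42) `display242` ⟹ `constrainedProp₂ = constrainedProp + ℋ·C^{(k)}·ℋᵀ`, the
  statement of `CovarianceSplitting.constrainedProp₂_eq` (the two proofs agree; this one is B1's by name);
* **`Qmat₂_mul_constrainedProp₂`** — B1 (2.41) `display241`: `Q_{k+1}G^ε_{k+1} = (a₁ + aL⁻²)·Q·C^{(k)}·Q_k·G^ε_k`;
* **`effLaplacian₂_eq`** — B1 (2.18)∕(2.21) `display221_succ` = THE OPERATOR-LEVEL COMPOSITION LAW OF KING'S (2.14): the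
  effective Laplacian of the composite blocks computed FROM THE FINE TORUS, `b·1 − b²(NL)^d·Q₂(B + b·Q₂^*Q₂)⁻¹Q₂ᵀ`
  (`b = nextLevelCoeff`), EQUALS the one computed in ONE block-spin step from `Δ^{(k)}`, `aL⁻²·1 − (aL⁻²)²L^d·Q·C^{(k)}·Qᵀ`
  (`T_{a,L}` applied to the level-`k` Gaussian `exp(−½⟨φ,Δ^{(k)}φ⟩)`) — the Gaussian-integration step that
  `King1986/TorusBlockForm`'s header left as the input behind the symbol identification (4.5) (the SYMBOL-level law being
  `King1986/CompositionLaw.composition_law`); and its flat-torus form in level-`(k+1)` units, **`effLaplacian_succ_flatten`**: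
  `effLaplacian (N·L) M (aK a L (k+1)) ((NL)²) (L²m²) = L²·(aL⁻²·1 − (aL⁻²)²L^d·Q·C^{(k)}·Qᵀ)` — King's `Δ^{(k+1)}` BY NAME
  (`Qmat_flatten`: the flat `(N·L)`-block mean is `Qmat₂ ∘ flatten⁻¹`).

**NOT COVERED.**  `A ≠ 0`; free boundary conditions; the `k`-fold tower (B1's `Tower.display243` is available for any
`Consistent` tower; building King's full nested tower as a `B1RG242.Tower` is bookkeeping on ask).  HONEST FRAMING: King's
∕ Bałaban's scalar block-spin MODEL on a finite torus — exact finite-dimensional algebra; nothing about Bałaban's covariant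
(`A ≠ 0`, non-abelian) objects; nothing continuum ∕ mass-gap ∕ Clay; count-neutral for the cell's 27 nodes.
-/

noncomputable section

open Finset Real Matrix
open scoped BigOperators

namespace Literature.MathematicalPhysics.QuantumFieldTheory.King1986

open Literature.MathematicalPhysics.QuantumFieldTheory.Balaban1983to89
open Literature.MathematicalPhysics.QuantumFieldTheory.Balaban1983to89.B5Prop11Plancherel

namespace Torus

variable {d : ℕ}

section TwoLevel

variable (N L : ℕ) [NeZero N] [NeZero L] (M : Fin d → ℕ) [hM : ∀ μ, NeZero (M μ)]

/-! ## §1 King's two-level data as a B1 renormalization step -/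

/-- **KING'S TWO-LEVEL BLOCK DATA AS A `B1RG242.StepData`** (level-`k` units on the nested torus): `H = N^{−d}·(c(−Δ)+m²)`,
`Q_k = Qmat N (fine L M)`, `Q_k^* = Q_kᵀ`, `Q = Qmat L M`, `Q^* = L^d·Qᵀ`, `α = a₁` (`= a_k`), `β = aL⁻²`.
[cite: King1986, (2.13)–(2.16) p.653; Balaban1982Higgs1, (2.7) p.608, (2.11) p.609, (2.17)/(2.20) p.610, (2.30) p.611] -/
def kingStep (a₁ a c m2 : ℝ) : B1RG242.StepData ℝ (Tor (fine N (fine L M))) (Tor (fine L M)) (Tor M) where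
  H := (((N : ℝ) ^ d)⁻¹) • lapF (fine N (fine L M)) c m2
  Qk := Qmat N (fine L M)
  Qks := (Qmat N (fine L M))ᵀ
  Q := Qmat L M
  Qs := ((L : ℝ) ^ d) • (Qmat L M)ᵀ
  α := a₁
  β := a * ((L : ℝ) ^ 2)⁻¹

variable (a₁ a c m2 : ℝ)

/-- `QQ^* = 1` for King's one-step mean with the unit-lattice adjoint `Q^* = L^dQᵀ` (`QQᵀ = L^{−d}`).
[cite: King1986, (2.10) p.653; Balaban1982Higgs1, (2.7) p.608] -/
theorem kingStep_QQs : (kingStep N L M a₁ a c m2).Q * (kingStep N L M a₁ a c m2).Qs = 1 := by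
  have hLd : ((L : ℝ) ^ d) ≠ 0 := pow_ne_zero _ (by exact_mod_cast NeZero.ne L)
  show Qmat L M * (((L : ℝ) ^ d) • (Qmat L M)ᵀ) = 1
  rw [Matrix.mul_smul, Qmat_mul_transpose_Qmat, smul_smul, mul_inv_cancel₀ hLd, one_smul]

/-- `P_k = Q_kᵀQ_k = N^{−d}·Q_k^*Q_k` (`blockProj`). [cite: Balaban1982Higgs1, (2.20) p.610; King1986, (2.13) p.653] -/
theorem kingStep_Pk : (kingStep N L M a₁ a c m2).Pk = (((N : ℝ) ^ d)⁻¹) • blockProj N (fine L M) :=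
  transpose_Qmat_mul_Qmat N (fine L M)

/-- `P = Q^*Q = blockProj L M`. [cite: Balaban1982Higgs1, (2.30) p.611; King1986, (2.16) p.653] -/
theorem kingStep_P : (kingStep N L M a₁ a c m2).P = blockProj L M := by
  have hLd : ((L : ℝ) ^ d) ≠ 0 := pow_ne_zero _ (by exact_mod_cast NeZero.ne L)
  show (((L : ℝ) ^ d) • (Qmat L M)ᵀ) * Qmat L M = blockProj L M
  rw [Matrix.smul_mul, transpose_Qmat_mul_Qmat, smul_smul, mul_inv_cancel₀ hLd, one_smul]

/-- The argument of `G_k`: `H + α·P_k = N^{−d}·A₀`. [cite: Balaban1982Higgs1, (2.20) p.610; King1986, (2.13) p.653] -/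
theorem kingStep_G_arg :
    (kingStep N L M a₁ a c m2).H + (kingStep N L M a₁ a c m2).α • (kingStep N L M a₁ a c m2).Pk
      = (((N : ℝ) ^ d)⁻¹) • fineOp N (fine L M) a₁ c m2 := by
  rw [kingStep_Pk, fineOp, smul_add, smul_smul, smul_smul, mul_comm]
  rfl

/-- `G_k` IS King's constrained propagator: `Gk = N^d·A₀⁻¹ = constrainedProp` (`c ≥ 0`, `m² > 0`, `a₁ ≥ 0`).
[cite: Balaban1982Higgs1, (2.20) p.610; King1986, (2.13) p.653] -/
theorem kingStep_Gk (ha₁ : 0 ≤ a₁) (hc : 0 ≤ c) (hm : 0 < m2) :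
    (kingStep N L M a₁ a c m2).Gk = constrainedProp N (fine L M) a₁ c m2 := by
  have hNd : ((N : ℝ) ^ d) ≠ 0 := pow_ne_zero _ (by exact_mod_cast NeZero.ne N)
  have hAu : IsUnit (fineOp N (fine L M) a₁ c m2).det :=
    (Matrix.isUnit_iff_isUnit_det _).mp (fineOp_isUnit N (fine L M) ha₁ hc hm)
  rw [B1RG242.StepData.Gk, kingStep_G_arg, constrainedProp]
  refine Matrix.inv_eq_right_inv ?_
  rw [Matrix.smul_mul, Matrix.mul_smul, smul_smul, inv_mul_cancel₀ hNd, one_smul, Matrix.mul_nonsing_inv _ hAu]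

/-- Hence `H + α·P_k` is invertible. [cite: Balaban1982Higgs1, (2.20) p.610] -/
theorem kingStep_isUnit_G (ha₁ : 0 ≤ a₁) (hc : 0 ≤ c) (hm : 0 < m2) :
    IsUnit ((kingStep N L M a₁ a c m2).H + (kingStep N L M a₁ a c m2).α • (kingStep N L M a₁ a c m2).Pk) := by
  have hNd : ((N : ℝ) ^ d) ≠ 0 := pow_ne_zero _ (by exact_mod_cast NeZero.ne N)
  have hAu : IsUnit (fineOp N (fine L M) a₁ c m2).det :=
    (Matrix.isUnit_iff_isUnit_det _).mp (fineOp_isUnit N (fine L M) ha₁ hc hm)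
  rw [kingStep_G_arg, Matrix.isUnit_iff_isUnit_det]
  refine Matrix.isUnit_det_of_right_inverse (B := ((N : ℝ) ^ d) • (fineOp N (fine L M) a₁ c m2)⁻¹) ?_
  rw [Matrix.smul_mul, Matrix.mul_smul, smul_smul, inv_mul_cancel₀ hNd, one_smul, Matrix.mul_nonsing_inv _ hAu]

/-- `Δ^{(k)}` IS King's effective Laplacian: `Δk = α·1 − α²·Q_kG_kQ_k^* = effLaplacian` — B1 (2.21) = King (2.14).
[cite: Balaban1982Higgs1, (2.21) p.610; King1986, (2.14) p.653] -/
theorem kingStep_Δk (ha₁ : 0 ≤ a₁) (hc : 0 ≤ c) (hm : 0 < m2) :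
    (kingStep N L M a₁ a c m2).Δk = effLaplacian N (fine L M) a₁ c m2 := by
  rw [B1RG242.StepData.Δk, kingStep_Gk N L M a₁ a c m2 ha₁ hc hm, constrainedProp, effLaplacian, Matrix.mul_smul,
    Matrix.smul_mul, smul_smul]
  rfl

/-- `C^{(k)}` IS King's one-step covariance: `Ck = (βP + Δ^{(k)})⁻¹ = oneStepCov` — B1 (2.30) = King (2.16).
[cite: Balaban1982Higgs1, (2.30) p.611; King1986, (2.16) p.653] -/
theorem kingStep_Ck (ha₁ : 0 ≤ a₁) (hc : 0 ≤ c) (hm : 0 < m2) :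
    (kingStep N L M a₁ a c m2).Ck = oneStepCov N L M a₁ a c m2 := by
  rw [B1RG242.StepData.Ck, kingStep_P, kingStep_Δk N L M a₁ a c m2 ha₁ hc hm, oneStepCov, add_comm]
  rfl

/-- Hence `βP + Δ^{(k)}` is invertible (`a₁ > 0`, `a ≥ 0`). [cite: Balaban1982Higgs1, (2.30) p.611 («It is so»)] -/
theorem kingStep_isUnit_C (ha₁ : 0 < a₁) (ha : 0 ≤ a) (hc : 0 ≤ c) (hm : 0 < m2) :
    IsUnit ((kingStep N L M a₁ a c m2).β • (kingStep N L M a₁ a c m2).P + (kingStep N L M a₁ a c m2).Δk) := by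
  rw [kingStep_P, kingStep_Δk N L M a₁ a c m2 ha₁.le hc hm, add_comm]
  exact isUnit_effLaplacian_add_blockProj N L M ha₁ ha hc hm

/-- `α + β ≠ 0` (`a₁, a > 0`). [cite: Balaban1982Higgs1, (2.13) p.609] -/
theorem kingStep_αβ_ne (ha₁ : 0 < a₁) (ha : 0 < a) :
    (kingStep N L M a₁ a c m2).α + (kingStep N L M a₁ a c m2).β ≠ 0 := by
  have hL0 : (0 : ℝ) < L := by exact_mod_cast Nat.pos_of_ne_zero (NeZero.ne L)
  show a₁ + a * ((L : ℝ) ^ 2)⁻¹ ≠ 0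
  positivity

/-- `γ = αβ∕(α + β)` IS the next coefficient `nextLevelCoeff a a₁ L` (= `a_{k+1}∕L²` at `a₁ = a_k`, `nextLevelCoeff_aK`) —
B1 (2.13) = King (2.13). [cite: Balaban1982Higgs1, (2.13) p.609; King1986, (2.13) p.653] -/
theorem kingStep_γ (ha₁ : 0 < a₁) (ha : 0 < a) : (kingStep N L M a₁ a c m2).γ = nextLevelCoeff a a₁ L := by
  have hL0 : (0 : ℝ) < L := by exact_mod_cast Nat.pos_of_ne_zero (NeZero.ne L)
  show a₁ * (a * ((L : ℝ) ^ 2)⁻¹) / (a₁ + a * ((L : ℝ) ^ 2)⁻¹) = a * a₁ / (a + a₁ * (L : ℝ) ^ 2)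
  field_simp
  ring

/-- `Q_{k+1} = QQ_k` IS the composite mean `Qmat₂`. [cite: Balaban1982Higgs1, (2.12)–(2.14) p.609; King1986, (2.10) p.653] -/
theorem kingStep_Qk1 : (kingStep N L M a₁ a c m2).Qk1 = Qmat₂ N L M := rfl

/-- `P_{k+1} = Q_{k+1}^*Q_{k+1} = N^{−d}·blockProj₂`. [cite: Balaban1982Higgs1, (2.20) p.610] -/
theorem kingStep_Pk1 : (kingStep N L M a₁ a c m2).Pk1 = (((N : ℝ) ^ d)⁻¹) • blockProj₂ N L M := by
  have hNd : ((N : ℝ) ^ d) ≠ 0 := pow_ne_zero _ (by exact_mod_cast NeZero.ne N)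
  show ((Qmat N (fine L M))ᵀ * (((L : ℝ) ^ d) • (Qmat L M)ᵀ)) * (Qmat L M * Qmat N (fine L M))
    = (((N : ℝ) ^ d)⁻¹) • blockProj₂ N L M
  rw [blockProj₂, Qmat₂, Matrix.transpose_mul, smul_smul, mul_pow, ← mul_assoc, inv_mul_cancel₀ hNd, one_mul,
    Matrix.mul_smul, Matrix.smul_mul]

/-- The argument of `G_{k+1}`: `H + γ·P_{k+1} = N^{−d}·(B + b·Q₂^*Q₂)`, `b = nextLevelCoeff`.
[cite: Balaban1982Higgs1, (2.20) p.610; King1986, (2.13) p.653] -/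
theorem kingStep_G1_arg (ha₁ : 0 < a₁) (ha : 0 < a) :
    (kingStep N L M a₁ a c m2).H + (kingStep N L M a₁ a c m2).γ • (kingStep N L M a₁ a c m2).Pk1
      = (((N : ℝ) ^ d)⁻¹) • (lapF (fine N (fine L M)) c m2 + (nextLevelCoeff a a₁ L) • blockProj₂ N L M) := by
  rw [kingStep_Pk1, kingStep_γ N L M a₁ a c m2 ha₁ ha, smul_add, smul_smul, smul_smul, mul_comm]
  rfl

/-- `G_{k+1}` IS the level-`(k+1)` constrained propagator of the splitting: `Gk1 = constrainedProp₂`.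
[cite: Balaban1982Higgs1, (2.20) p.610; King1986, (2.13) p.653, (2.17) p.653] -/
theorem kingStep_Gk1 (ha₁ : 0 < a₁) (ha : 0 < a) (hc : 0 ≤ c) (hm : 0 < m2) :
    (kingStep N L M a₁ a c m2).Gk1 = constrainedProp₂ N L M a₁ a c m2 := by
  have hNd : ((N : ℝ) ^ d) ≠ 0 := pow_ne_zero _ (by exact_mod_cast NeZero.ne N)
  have hb : 0 ≤ nextLevelCoeff a a₁ L := by unfold nextLevelCoeff; positivity
  have hTu : IsUnit (lapF (fine N (fine L M)) c m2 + (nextLevelCoeff a a₁ L) • blockProj₂ N L M).det :=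
    (Matrix.isUnit_iff_isUnit_det _).mp (isUnit_lapF_add_blockProj₂ N L M hb hc hm)
  rw [B1RG242.StepData.Gk1, kingStep_G1_arg N L M a₁ a c m2 ha₁ ha, constrainedProp₂]
  refine Matrix.inv_eq_right_inv ?_
  rw [Matrix.smul_mul, Matrix.mul_smul, smul_smul, inv_mul_cancel₀ hNd, one_smul, Matrix.mul_nonsing_inv _ hTu]

/-! ## §2 B1's step identities read on King's operators by name -/

/-- **B1 (2.42) `display242` ⟹ KING'S (2.17) ONE STEP**: `constrainedProp₂ = constrainedProp + ℋ·C^{(k)}·ℋᵀ` — the statement of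
`CovarianceSplitting.constrainedProp₂_eq`, here DERIVED from Bałaban's kernel-proved step identity through the dictionary of §1.
[cite: Balaban1982Higgs1, (2.42) p.612; King1986, (2.17) p.653] -/
theorem constrainedProp₂_eq_of_display242 (ha : 0 < a) (ha₁ : 0 < a₁) (hc : 0 ≤ c) (hm : 0 < m2) :
    constrainedProp₂ N L M a₁ a c m2
      = constrainedProp N (fine L M) a₁ c m2
        + minimiserMat N (fine L M) a₁ c m2 * oneStepCov N L M a₁ a c m2 * (minimiserMat N (fine L M) a₁ c m2)ᵀ := by
  set S := kingStep N L M a₁ a c m2 with hS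
  have h242 := S.display242 (kingStep_QQs N L M a₁ a c m2) (kingStep_αβ_ne N L M a₁ a c m2 ha₁ ha)
    (kingStep_isUnit_G N L M a₁ a c m2 ha₁.le hc hm) (kingStep_isUnit_C N L M a₁ a c m2 ha₁ ha.le hc hm)
  rw [kingStep_Gk1 N L M a₁ a c m2 ha₁ ha hc hm, kingStep_Gk N L M a₁ a c m2 ha₁.le hc hm,
    kingStep_Ck N L M a₁ a c m2 ha₁.le hc hm] at h242
  rw [h242, add_comm, transpose_minimiserMat, minimiserMat, constrainedProp]
  congr 1
  show a₁ ^ 2 • ((((N : ℝ) ^ d) • (fineOp N (fine L M) a₁ c m2)⁻¹) * (Qmat N (fine L M))ᵀ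
      * oneStepCov N L M a₁ a c m2 * Qmat N (fine L M) * (((N : ℝ) ^ d) • (fineOp N (fine L M) a₁ c m2)⁻¹)) = _
  simp only [Matrix.smul_mul, Matrix.mul_smul, smul_smul, Matrix.mul_assoc]
  congr 1
  ring

/-- **B1 (2.41) `display241` for King's operators**: `Q_{k+1}·G^ε_{k+1} = (a₁ + aL⁻²)·Q·C^{(k)}·Q_k·G^ε_k` — the composite mean of the
level-`(k+1)` propagator factors through the one-step covariance. [cite: Balaban1982Higgs1, (2.41) p.612; King1986, (2.13)–(2.16) p.653] -/
theorem Qmat₂_mul_constrainedProp₂ (ha : 0 < a) (ha₁ : 0 < a₁) (hc : 0 ≤ c) (hm : 0 < m2) :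
    Qmat₂ N L M * constrainedProp₂ N L M a₁ a c m2
      = (a₁ + a * ((L : ℝ) ^ 2)⁻¹)
          • (Qmat L M * oneStepCov N L M a₁ a c m2 * Qmat N (fine L M) * constrainedProp N (fine L M) a₁ c m2) := by
  set S := kingStep N L M a₁ a c m2 with hS
  have h241 := S.display241 (kingStep_QQs N L M a₁ a c m2) (kingStep_αβ_ne N L M a₁ a c m2 ha₁ ha)
    (kingStep_isUnit_G N L M a₁ a c m2 ha₁.le hc hm) (kingStep_isUnit_C N L M a₁ a c m2 ha₁ ha.le hc hm)
  rw [kingStep_Gk1 N L M a₁ a c m2 ha₁ ha hc hm, kingStep_Gk N L M a₁ a c m2 ha₁.le hc hm,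
    kingStep_Ck N L M a₁ a c m2 ha₁.le hc hm, kingStep_Qk1] at h241
  exact h241

/-- **THE OPERATOR-LEVEL COMPOSITION LAW OF THE EFFECTIVE LAPLACIAN (B1 (2.18)∕(2.21) `display221_succ` for King's operators =
King's (2.14) across two levels)**: the effective Laplacian of the composite `(NL)`-blocks computed FROM THE FINE TORUS,
`b·1 − b²(NL)^d·Q₂(B + b·Q₂^*Q₂)⁻¹Q₂ᵀ` (`b = nextLevelCoeff a a₁ L = a_{k+1}∕L²`; the `effLaplacian` recipe at block size `N·L`,
in level-`k` units), EQUALS the one obtained in ONE block-spin step `T_{a,L}` from the level-`k` Gaussian `exp(−½⟨φ, Δ^{(k)}φ⟩)`,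
`aL⁻²·1 − (aL⁻²)²L^d·Q·C^{(k)}·Qᵀ`.  (The SYMBOL-level law is `King1986/CompositionLaw.composition_law`; this is the operator
statement behind it.) [cite: Balaban1982Higgs1, (2.18)/(2.21) p.610, (2.41) p.612; King1986, (2.14) p.653, (4.12) p.671] -/
theorem effLaplacian₂_eq (ha : 0 < a) (ha₁ : 0 < a₁) (hc : 0 ≤ c) (hm : 0 < m2) :
    (a * ((L : ℝ) ^ 2)⁻¹) • (1 : Matrix (Tor M) (Tor M) ℝ)
        - ((a * ((L : ℝ) ^ 2)⁻¹) ^ 2 * (L : ℝ) ^ d) • (Qmat L M * oneStepCov N L M a₁ a c m2 * (Qmat L M)ᵀ)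
      = (nextLevelCoeff a a₁ L) • (1 : Matrix (Tor M) (Tor M) ℝ)
        - ((nextLevelCoeff a a₁ L) ^ 2 * ((N : ℝ) * L) ^ d)
          • (Qmat₂ N L M * (lapF (fine N (fine L M)) c m2 + (nextLevelCoeff a a₁ L) • blockProj₂ N L M)⁻¹
              * (Qmat₂ N L M)ᵀ) := by
  have hNd : ((N : ℝ) ^ d) ≠ 0 := pow_ne_zero _ (by exact_mod_cast NeZero.ne N)
  set S := kingStep N L M a₁ a c m2 with hS
  have h221 := S.display221_succ (kingStep_QQs N L M a₁ a c m2) (kingStep_αβ_ne N L M a₁ a c m2 ha₁ ha)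
    (kingStep_isUnit_G N L M a₁ a c m2 ha₁.le hc hm) (kingStep_isUnit_C N L M a₁ a c m2 ha₁ ha.le hc hm)
  rw [kingStep_Gk1 N L M a₁ a c m2 ha₁ ha hc hm, kingStep_Ck N L M a₁ a c m2 ha₁.le hc hm, kingStep_Qk1,
    kingStep_γ N L M a₁ a c m2 ha₁ ha] at h221
  -- `h221 : β•1 − β²•(q * C * (L^d • qᵀ)) = b•1 − b²•(Q₂ * constrainedProp₂ * (Qᵀ * (L^d • qᵀ)))`
  have e1 : S.Q * oneStepCov N L M a₁ a c m2 * S.Qs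
      = ((L : ℝ) ^ d) • (Qmat L M * oneStepCov N L M a₁ a c m2 * (Qmat L M)ᵀ) := by
    show Qmat L M * oneStepCov N L M a₁ a c m2 * (((L : ℝ) ^ d) • (Qmat L M)ᵀ) = _
    rw [Matrix.mul_smul]
  have e2 : Qmat₂ N L M * constrainedProp₂ N L M a₁ a c m2 * S.Qk1s
      = (((N : ℝ) * L) ^ d) • (Qmat₂ N L M * (lapF (fine N (fine L M)) c m2
          + (nextLevelCoeff a a₁ L) • blockProj₂ N L M)⁻¹ * (Qmat₂ N L M)ᵀ) := by
    show Qmat₂ N L M * constrainedProp₂ N L M a₁ a c m2 * ((Qmat N (fine L M))ᵀ * (((L : ℝ) ^ d) • (Qmat L M)ᵀ)) = _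
    rw [constrainedProp₂, Qmat₂, Matrix.transpose_mul, Matrix.mul_smul, Matrix.mul_smul, Matrix.smul_mul,
      Matrix.mul_smul, smul_smul, mul_pow]
  rw [e1, e2, smul_smul, smul_smul] at h221
  exact h221

/-- The flat `(N·L)`-block mean is the composite mean through the re-indexing: `Qmat (N·L) M z (flatten x) = Qmat₂ N L M z x`.
[cite: King1986, (2.10) p.653, (2.20) p.654] -/
theorem Qmat_flatten (z : Tor M) (x : Tor (fine N (fine L M))) :
    Qmat (N * L) M z (flatten N L M x) = Qmat₂ N L M z x := by
  rw [Qmat₂_apply, Qmat, blockOf_flatten, Nat.cast_mul]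

/-- Sandwich sums transport along `flatten`: `Q'·X'·Q'ᵀ` on the flat torus with `X' = reindex X` equals `Q₂·X·Q₂ᵀ`.
[cite: King1986, (2.20) p.654] -/
theorem Qmat_sandwich_flatten (X : Matrix (Tor (fine N (fine L M))) (Tor (fine N (fine L M))) ℝ) :
    Qmat (N * L) M * Matrix.reindex (flatten N L M) (flatten N L M) X * (Qmat (N * L) M)ᵀ
      = Qmat₂ N L M * X * (Qmat₂ N L M)ᵀ := by
  ext z z'
  simp only [Matrix.mul_apply, Matrix.transpose_apply, Matrix.reindex_apply, Matrix.submatrix_apply]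
  rw [← (flatten N L M).sum_comp]
  refine Finset.sum_congr rfl fun y _ => ?_
  rw [Qmat_flatten, Equiv.symm_apply_apply, ← (flatten N L M).sum_comp]
  refine congrArg (· * _) (Finset.sum_congr rfl fun x _ => ?_)
  rw [Qmat_flatten, Equiv.symm_apply_apply]

/-- **KING'S `Δ^{(k+1)}` BY NAME = `L²·`(ONE BLOCK-SPIN STEP APPLIED TO `Δ^{(k)}`)**: with `a₁ = a_k = aK a L k` (`k ≥ 1`, `L ≥ 2`),
`effLaplacian (N·L) M (aK a L (k+1)) ((NL)²) (L²m²) = L²·(aL⁻²·1 − (aL⁻²)²L^d·Q·C^{(k)}·Qᵀ)` — the left side is (2.14) at level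
`k + 1` computed from the fine torus in its own units (the factor `L²` is the (2.20)∕`a_k(L^kε)^{−2}` change of units), the right
side the composition `T_{a,L} ∘ T_{a_k,L^k}` read on effective Laplacians. [cite: King1986, (2.14) p.653, (2.20) p.654, (4.12) p.671; Balaban1982Higgs1, (2.18)/(2.21) p.610] -/
theorem effLaplacian_succ_flatten (ha : 0 < a) (hL : 2 ≤ L) {k : ℕ} (hk : 1 ≤ k) (hm : 0 < m2) :
    effLaplacian (N * L) M (aK a L (k + 1)) (((N * L : ℕ) : ℝ) ^ 2) (((L : ℝ) ^ 2) * m2)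
      = ((L : ℝ) ^ 2) • ((a * ((L : ℝ) ^ 2)⁻¹) • (1 : Matrix (Tor M) (Tor M) ℝ)
          - ((a * ((L : ℝ) ^ 2)⁻¹) ^ 2 * (L : ℝ) ^ d)
            • (Qmat L M * oneStepCov N L M (aK a L k) a ((N : ℝ) ^ 2) m2 * (Qmat L M)ᵀ)) := by
  have hLr : (1 : ℝ) < L := by exact_mod_cast (show 1 < L by omega)
  have hL0 : (0 : ℝ) < L := by positivity
  have hL2 : ((L : ℝ) ^ 2) ≠ 0 := pow_ne_zero _ hL0.ne'
  have hak : 0 < aK a L k := aK_pos ha hLr hk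
  set b := nextLevelCoeff a (aK a L k) L with hb
  have hb0 : 0 ≤ b := by rw [hb]; unfold nextLevelCoeff; positivity
  set T := lapF (fine N (fine L M)) ((N : ℝ) ^ 2) m2 + b • blockProj₂ N L M with hT
  have h1 : aK a L (k + 1) = ((L : ℝ) ^ 2) * b := by rw [hb, nextLevelCoeff_aK ha hLr hk, mul_div_cancel₀ _ hL2]
  have h2 : (((N * L : ℕ) : ℝ) ^ 2) = ((L : ℝ) ^ 2) * ((N : ℝ) ^ 2) := by push_cast; ring
  -- the flat minimisation operator and its inverse
  have hre : fineOp (N * L) M (((L : ℝ) ^ 2) * b) (((L : ℝ) ^ 2) * ((N : ℝ) ^ 2)) (((L : ℝ) ^ 2) * m2)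
      = Matrix.reindex (flatten N L M) (flatten N L M) (((L : ℝ) ^ 2) • T) := by
    rw [fineOp_succ_eq_reindex, hT, mul_comm ((L : ℝ) ^ 2) b, mul_assoc, mul_inv_cancel₀ hL2, mul_one]
  have hTu : IsUnit T.det := (Matrix.isUnit_iff_isUnit_det _).mp (isUnit_lapF_add_blockProj₂ N L M hb0 (sq_nonneg _) hm)
  have hinv : (((L : ℝ) ^ 2) • T)⁻¹ = (((L : ℝ) ^ 2)⁻¹) • T⁻¹ := by
    refine Matrix.inv_eq_right_inv ?_
    rw [Matrix.smul_mul, Matrix.mul_smul, smul_smul, mul_inv_cancel₀ hL2, one_smul, Matrix.mul_nonsing_inv T hTu]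
  rw [h1, h2, effLaplacian, hre, Matrix.inv_reindex, hinv]
  have hsand : Qmat (N * L) M * Matrix.reindex (flatten N L M) (flatten N L M) ((((L : ℝ) ^ 2)⁻¹) • T⁻¹) * (Qmat (N * L) M)ᵀ
      = (((L : ℝ) ^ 2)⁻¹) • (Qmat₂ N L M * T⁻¹ * (Qmat₂ N L M)ᵀ) := by
    have := Qmat_sandwich_flatten N L M ((((L : ℝ) ^ 2)⁻¹) • T⁻¹)
    rw [this, Matrix.mul_smul, Matrix.smul_mul]
  rw [hsand, effLaplacian₂_eq N L M (aK a L k) a ((N : ℝ) ^ 2) m2 ha hak (sq_nonneg _) hm, ← hb, ← hT, Nat.cast_mul]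
  simp only [smul_sub, smul_smul]
  congr 1
  congr 1
  field_simp

end TwoLevel

end Torus

end Literature.MathematicalPhysics.QuantumFieldTheory.King1986
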